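import Summits.ValiantsHypothesis.ValiantsHypothesis.Theorems.MonotoneRestorationOrbitRestorationQPProductAction
import HarnessLib

/-!
# Transposition signs of affine forms (ORBIT currency, ΠΣ sub-rung: FACT 1 of the keyed-block rule)

Route MonotoneRestoration, crux `OrbitRestorationQP` (stmt-ValiantsHypothesis-18293), line `depth-three-rung`,
stub A₁ `stub_piSigmaValue` (the ΠΣ sub-rung in value currency), namespace
`Summit.ValiantsHypothesis.ValiantsHypothesis.Theorems.TranspositionSigns`.

The residual of the `k = 1` sub-rung is the SIGN-TWISTED part: factors `ℓ` of a matrix-symmetric affine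
product that some transposition rescales by `-1` (crux workfile `Cruxes/OrbitRestorationQP/PISIGMA-SUBRUNG.md`,
rule M2′ and its invariants `X_R`, `X_C`).  This file proves the first fact the rule rests on, for an
arbitrary field in which `2 ≠ 0`:

* `coeff_perm_eq_neg_of_rename_eq_neg`, `coeff_eq_zero_of_rename_eq_neg`, `coeff_zero_eq_zero_of_rename_eq_neg`
  — if a renaming `rename e` by a permutation `e` of the positions NEGATES a polynomial `q` of total degree
  `≤ 1`, then the coefficient function of `q` is `e`-ANTI-invariant, vanishes at every position fixed by `e`,
  and the constant term vanishes;
* **FACT 1 (rows)** `row_coeff_eq_zero_of_swap_neg`, `row_coeff_eq_neg_of_swap_neg`, `rowFix_of_swap_neg`,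
  `eq_zero_of_row_swap_neg_of_rowFix` — if the PURE ROW transposition `(a b)` negates `q`, then `q` lives on the
  rows `a, b` with opposite coefficients, is fixed by every row permutation fixing `a` and `b`, and is `0` as
  soon as it is also fixed by the row permutations fixing pointwise a set `Y ∌ a` with `|Y| + 3 ≤ n`
  (so the row support of a nonzero such `q` is exactly `{a, b}`: "`X_R = -1 ⇒ |R| = 2`");
* **FACT 1 (columns)** the same for the pure column transposition (`col_…`);
* `diag_coeff_eq_zero_of_swap_neg` — if the DIAGONAL transposition `(a b)` negates `q`, every coefficient at a
  position avoiding `a` and `b` in both coordinates vanishes (diagonal sign transpositions live inside every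
  support of `q`).

Vocabulary: `ProductAction.vact rowHom / colHom` (pure row / column actions), `ren` (diagonal action),
`ProductAction.rename_affine`, `HomogTools.eq_C_add_sum_of_totalDegree_le_one`.  Everything is proved; nothing
here is specific to `ℂ`. [folklore]

## References
* A. Dawar, G. Wilsenach, *Symmetric arithmetic circuits*, ToC 21 (2025), §3.3 (supports). [DawarWilsenach2025]
-/

noncomputable section

open scoped Classical

-- `Summit.ValiantsHypothesis.ValiantsHypothesis.…` is the tree's single-conjunct layout (Sub = Summit).
set_option linter.dupNamespace false

namespace Summit.ValiantsHypothesis.ValiantsHypothesis.Theorems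

namespace TranspositionSigns

open MvPolynomial Equiv ProductAction

variable {n : ℕ} {K : Type} [Field K]

/-! ### A renaming that negates an affine form -/

/-- If `rename e q = -q` for a polynomial `q` of total degree `≤ 1`, the linear coefficients of `q` are
`e`-anti-invariant: `c (e v) = - c v`. [folklore] -/
theorem coeff_perm_eq_neg_of_rename_eq_neg (e : Perm (Fin n × Fin n)) {q : MvPolynomial (Fin n × Fin n) K}
    (hq : q.totalDegree ≤ 1) (h : rename e q = -q) (v : Fin n × Fin n) :
    coeff (Finsupp.single (e v) 1) q = -coeff (Finsupp.single v 1) q := by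
  set c₀ := coeff 0 q with hc₀
  set c : Fin n × Fin n → K := fun w => coeff (Finsupp.single w 1) q with hc
  have hqe : q = C c₀ + ∑ w, C (c w) * X w := HomogTools.eq_C_add_sum_of_totalDegree_le_one hq
  have h1 := congrArg (coeff (Finsupp.single (e v) 1)) h
  rw [hqe, rename_affine, coeff_neg, coeff_single_affine c₀ (fun w => c (e.symm w)),
    coeff_single_affine] at h1
  have h2 : c v = -c (e v) := by simpa using h1
  change c (e v) = -c v
  rw [h2, neg_neg]

/-- If `rename e q = -q` (`q` of total degree `≤ 1`, `2 ≠ 0` in `K`), the coefficient of `q` at every position FIXED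
by `e` vanishes. [folklore] -/
theorem coeff_eq_zero_of_rename_eq_neg (h2 : (2 : K) ≠ 0) (e : Perm (Fin n × Fin n))
    {q : MvPolynomial (Fin n × Fin n) K} (hq : q.totalDegree ≤ 1) (h : rename e q = -q)
    {v : Fin n × Fin n} (hv : e v = v) : coeff (Finsupp.single v 1) q = 0 := by
  have h1 := coeff_perm_eq_neg_of_rename_eq_neg e hq h v
  rw [hv] at h1
  have : (2 : K) * coeff (Finsupp.single v 1) q = 0 := by linear_combination h1
  exact (mul_eq_zero.1 this).resolve_left h2

/-- If `rename e q = -q` (`2 ≠ 0` in `K`), the constant term of `q` vanishes (renaming fixes constants). [folklore] -/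
theorem coeff_zero_eq_zero_of_rename_eq_neg (h2 : (2 : K) ≠ 0) (e : Perm (Fin n × Fin n))
    {q : MvPolynomial (Fin n × Fin n) K} (h : rename e q = -q) : coeff 0 q = 0 := by
  have h1 := congrArg (coeff 0) h
  rw [← constantCoeff_eq, constantCoeff_rename, constantCoeff_eq, coeff_neg] at h1
  have : (2 : K) * coeff 0 q = 0 := by linear_combination h1
  exact (mul_eq_zero.1 this).resolve_left h2

/-! ### FACT 1 for rows: a pure row transposition negating an affine form -/

/-- **FACT 1 (rows), vanishing.** If the pure row transposition `(a b)` negates `q` (total degree `≤ 1`, `2 ≠ 0`),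
every coefficient of `q` off the rows `a, b` vanishes. [folklore] -/
theorem row_coeff_eq_zero_of_swap_neg (h2 : (2 : K) ≠ 0) {a b : Fin n} {q : MvPolynomial (Fin n × Fin n) K}
    (hq : q.totalDegree ≤ 1) (h : vact (K := K) rowHom (swap a b) q = -q) {i : Fin n} (hia : i ≠ a)
    (hib : i ≠ b) (j : Fin n) : coeff (Finsupp.single (i, j) 1) q = 0 := by
  rw [vact_apply] at h
  exact coeff_eq_zero_of_rename_eq_neg h2 _ hq h (by simp [swap_apply_of_ne_of_ne hia hib])

/-- **FACT 1 (rows), antisymmetry.** If the pure row transposition `(a b)` negates `q` (total degree `≤ 1`), the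
rows `a` and `b` of its coefficient matrix are opposite. [folklore] -/
theorem row_coeff_eq_neg_of_swap_neg {a b : Fin n} {q : MvPolynomial (Fin n × Fin n) K}
    (hq : q.totalDegree ≤ 1) (h : vact (K := K) rowHom (swap a b) q = -q) (j : Fin n) :
    coeff (Finsupp.single (b, j) 1) q = -coeff (Finsupp.single (a, j) 1) q := by
  rw [vact_apply] at h
  have := coeff_perm_eq_neg_of_rename_eq_neg _ hq h (a, j)
  simpa using this

/-- **FACT 1 (rows), constant term.** If a pure row transposition negates `q` (`2 ≠ 0`), `q` has no constant term.
[folklore] -/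
theorem row_coeff_zero_eq_zero_of_swap_neg (h2 : (2 : K) ≠ 0) {a b : Fin n}
    {q : MvPolynomial (Fin n × Fin n) K} (h : vact (K := K) rowHom (swap a b) q = -q) : coeff 0 q = 0 := by
  rw [vact_apply] at h
  exact coeff_zero_eq_zero_of_rename_eq_neg h2 _ h

/-- **FACT 1 (rows), support `⊆ {a, b}`.** If the pure row transposition `(a b)` negates `q` (total degree `≤ 1`,
`2 ≠ 0`), then every row permutation fixing `a` and `b` fixes `q`. [folklore] -/
theorem rowFix_of_swap_neg (h2 : (2 : K) ≠ 0) {a b : Fin n} {q : MvPolynomial (Fin n × Fin n) K}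
    (hq : q.totalDegree ≤ 1) (h : vact (K := K) rowHom (swap a b) q = -q) (ρ : Perm (Fin n))
    (ha : ρ a = a) (hb : ρ b = b) : vact (K := K) rowHom ρ q = q := by
  have hqe := HomogTools.eq_C_add_sum_of_totalDegree_le_one hq
  rw [vact_apply, hqe, rename_affine_eq_self_iff]
  rintro ⟨i, j⟩
  simp only [rowHom_apply]
  by_cases hia : i = a
  · subst hia; rw [ha]
  by_cases hib : i = b
  · subst hib; rw [hb]
  have hρa : ρ i ≠ a := fun h' => hia (ρ.injective (h'.trans ha.symm))
  have hρb : ρ i ≠ b := fun h' => hib (ρ.injective (h'.trans hb.symm))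
  rw [row_coeff_eq_zero_of_swap_neg h2 hq h hia hib j, row_coeff_eq_zero_of_swap_neg h2 hq h hρa hρb j]

/-- **FACT 1 (rows), minimality: the row support is EXACTLY `{a, b}`.** If the pure row transposition `(a b)`
negates `q` (total degree `≤ 1`, `2 ≠ 0`) and `q` is moreover fixed by every row permutation fixing
pointwise a set `Y` with `a ∉ Y` and `|Y| + 3 ≤ n`, then `q = 0`. [folklore] -/
theorem eq_zero_of_row_swap_neg_of_rowFix (h2 : (2 : K) ≠ 0) {a b : Fin n}
    {q : MvPolynomial (Fin n × Fin n) K} (hq : q.totalDegree ≤ 1) (h : vact (K := K) rowHom (swap a b) q = -q)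
    {Y : Finset (Fin n)} (haY : a ∉ Y) (hY : Y.card + 3 ≤ n)
    (hfix : ∀ ρ : Perm (Fin n), (∀ y ∈ Y, ρ y = y) → vact (K := K) rowHom ρ q = q) : q = 0 := by
  -- a free row index `i ∉ Y ∪ {a, b}`
  have hbig : 0 < (Finset.univ \ (Y ∪ {a, b})).card := by
    rw [Finset.card_sdiff_of_subset (Finset.subset_univ _), Finset.card_univ, Fintype.card_fin]
    have := (Finset.card_union_le Y {a, b}).trans (Nat.add_le_add_left (Finset.card_insert_le _ _) _)
    rw [Finset.card_singleton] at this
    omega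
  obtain ⟨i, hi⟩ := Finset.card_pos.1 hbig
  simp only [Finset.mem_sdiff, Finset.mem_univ, Finset.mem_union, Finset.mem_insert, Finset.mem_singleton,
    true_and, not_or] at hi
  obtain ⟨hiY, hia, hib⟩ := hi
  -- the row transposition `(a i)` fixes `Y` pointwise, hence fixes `q`
  have hρ := hfix (swap a i) fun y hy => by
    apply swap_apply_of_ne_of_ne
    · rintro rfl; exact haY hy
    · rintro rfl; exact hiY hy
  have hqe := HomogTools.eq_C_add_sum_of_totalDegree_le_one hq
  rw [vact_apply, hqe, rename_affine_eq_self_iff] at hρ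
  -- so row `a` of the coefficient matrix equals row `i`, which vanishes
  have hrow_a : ∀ j, coeff (Finsupp.single (a, j) 1) q = 0 := by
    intro j
    have := hρ (a, j)
    simp only [rowHom_apply, swap_apply_left] at this
    rw [← this]
    exact row_coeff_eq_zero_of_swap_neg h2 hq h hia hib j
  have hall : ∀ v : Fin n × Fin n, coeff (Finsupp.single v 1) q = 0 := by
    rintro ⟨i', j⟩
    by_cases h1 : i' = a
    · subst h1; exact hrow_a j
    by_cases h2' : i' = b
    · subst h2'; rw [row_coeff_eq_neg_of_swap_neg hq h j, hrow_a j, neg_zero]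
    exact row_coeff_eq_zero_of_swap_neg h2 hq h h1 h2' j
  rw [hqe, row_coeff_zero_eq_zero_of_swap_neg h2 h, C_0, zero_add]
  exact Finset.sum_eq_zero fun v _ => by rw [hall v, C_0, zero_mul]

/-! ### FACT 1 for columns -/

/-- **FACT 1 (columns), vanishing.** If the pure column transposition `(a b)` negates `q` (total degree `≤ 1`,
`2 ≠ 0`), every coefficient of `q` off the columns `a, b` vanishes. [folklore] -/
theorem col_coeff_eq_zero_of_swap_neg (h2 : (2 : K) ≠ 0) {a b : Fin n} {q : MvPolynomial (Fin n × Fin n) K}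
    (hq : q.totalDegree ≤ 1) (h : vact (K := K) colHom (swap a b) q = -q) (i : Fin n) {j : Fin n} (hja : j ≠ a)
    (hjb : j ≠ b) : coeff (Finsupp.single (i, j) 1) q = 0 := by
  rw [vact_apply] at h
  exact coeff_eq_zero_of_rename_eq_neg h2 _ hq h (by simp [swap_apply_of_ne_of_ne hja hjb])

/-- **FACT 1 (columns), antisymmetry.** If the pure column transposition `(a b)` negates `q` (total degree `≤ 1`),
the columns `a` and `b` of its coefficient matrix are opposite. [folklore] -/
theorem col_coeff_eq_neg_of_swap_neg {a b : Fin n} {q : MvPolynomial (Fin n × Fin n) K}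
    (hq : q.totalDegree ≤ 1) (h : vact (K := K) colHom (swap a b) q = -q) (i : Fin n) :
    coeff (Finsupp.single (i, b) 1) q = -coeff (Finsupp.single (i, a) 1) q := by
  rw [vact_apply] at h
  have := coeff_perm_eq_neg_of_rename_eq_neg _ hq h (i, a)
  simpa using this

/-- **FACT 1 (columns), constant term.** If a pure column transposition negates `q` (`2 ≠ 0`), `q` has no constant
term. [folklore] -/
theorem col_coeff_zero_eq_zero_of_swap_neg (h2 : (2 : K) ≠ 0) {a b : Fin n}
    {q : MvPolynomial (Fin n × Fin n) K} (h : vact (K := K) colHom (swap a b) q = -q) : coeff 0 q = 0 := by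
  rw [vact_apply] at h
  exact coeff_zero_eq_zero_of_rename_eq_neg h2 _ h

/-- **FACT 1 (columns), support `⊆ {a, b}`.** If the pure column transposition `(a b)` negates `q` (total degree
`≤ 1`, `2 ≠ 0`), then every column permutation fixing `a` and `b` fixes `q`. [folklore] -/
theorem colFix_of_swap_neg (h2 : (2 : K) ≠ 0) {a b : Fin n} {q : MvPolynomial (Fin n × Fin n) K}
    (hq : q.totalDegree ≤ 1) (h : vact (K := K) colHom (swap a b) q = -q) (ρ : Perm (Fin n))
    (ha : ρ a = a) (hb : ρ b = b) : vact (K := K) colHom ρ q = q := by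
  have hqe := HomogTools.eq_C_add_sum_of_totalDegree_le_one hq
  rw [vact_apply, hqe, rename_affine_eq_self_iff]
  rintro ⟨i, j⟩
  simp only [colHom_apply]
  by_cases hja : j = a
  · subst hja; rw [ha]
  by_cases hjb : j = b
  · subst hjb; rw [hb]
  have hρa : ρ j ≠ a := fun h' => hja (ρ.injective (h'.trans ha.symm))
  have hρb : ρ j ≠ b := fun h' => hjb (ρ.injective (h'.trans hb.symm))
  rw [col_coeff_eq_zero_of_swap_neg h2 hq h i hja hjb, col_coeff_eq_zero_of_swap_neg h2 hq h i hρa hρb]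

/-- **FACT 1 (columns), minimality: the column support is EXACTLY `{a, b}`.** If the pure column transposition
`(a b)` negates `q` (total degree `≤ 1`, `2 ≠ 0`) and `q` is fixed by every column permutation fixing
pointwise a set `Y` with `a ∉ Y` and `|Y| + 3 ≤ n`, then `q = 0`. [folklore] -/
theorem eq_zero_of_col_swap_neg_of_colFix (h2 : (2 : K) ≠ 0) {a b : Fin n}
    {q : MvPolynomial (Fin n × Fin n) K} (hq : q.totalDegree ≤ 1) (h : vact (K := K) colHom (swap a b) q = -q)
    {Y : Finset (Fin n)} (haY : a ∉ Y) (hY : Y.card + 3 ≤ n)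
    (hfix : ∀ ρ : Perm (Fin n), (∀ y ∈ Y, ρ y = y) → vact (K := K) colHom ρ q = q) : q = 0 := by
  have hbig : 0 < (Finset.univ \ (Y ∪ {a, b})).card := by
    rw [Finset.card_sdiff_of_subset (Finset.subset_univ _), Finset.card_univ, Fintype.card_fin]
    have := (Finset.card_union_le Y {a, b}).trans (Nat.add_le_add_left (Finset.card_insert_le _ _) _)
    rw [Finset.card_singleton] at this
    omega
  obtain ⟨j, hj⟩ := Finset.card_pos.1 hbig
  simp only [Finset.mem_sdiff, Finset.mem_univ, Finset.mem_union, Finset.mem_insert, Finset.mem_singleton,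
    true_and, not_or] at hj
  obtain ⟨hjY, hja, hjb⟩ := hj
  have hρ := hfix (swap a j) fun y hy => by
    apply swap_apply_of_ne_of_ne
    · rintro rfl; exact haY hy
    · rintro rfl; exact hjY hy
  have hqe := HomogTools.eq_C_add_sum_of_totalDegree_le_one hq
  rw [vact_apply, hqe, rename_affine_eq_self_iff] at hρ
  have hcol_a : ∀ i, coeff (Finsupp.single (i, a) 1) q = 0 := by
    intro i
    have := hρ (i, a)
    simp only [colHom_apply, swap_apply_left] at this
    rw [← this]
    exact col_coeff_eq_zero_of_swap_neg h2 hq h i hja hjb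
  have hall : ∀ v : Fin n × Fin n, coeff (Finsupp.single v 1) q = 0 := by
    rintro ⟨i, j'⟩
    by_cases h1 : j' = a
    · subst h1; exact hcol_a i
    by_cases h2' : j' = b
    · subst h2'; rw [col_coeff_eq_neg_of_swap_neg hq h i, hcol_a i, neg_zero]
    exact col_coeff_eq_zero_of_swap_neg h2 hq h i h1 h2'
  rw [hqe, col_coeff_zero_eq_zero_of_swap_neg h2 h, C_0, zero_add]
  exact Finset.sum_eq_zero fun v _ => by rw [hall v, C_0, zero_mul]

/-! ### Diagonal sign transpositions live inside the support -/

/-- **Diagonal sign transpositions.** If the DIAGONAL transposition `(a b)` negates `q` (total degree `≤ 1`,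
`2 ≠ 0`), every coefficient of `q` at a position `(i, j)` with `i, j ∉ {a, b}` vanishes, and so does the constant
term. [folklore] -/
theorem diag_coeff_eq_zero_of_swap_neg (h2 : (2 : K) ≠ 0) {a b : Fin n} {q : MvPolynomial (Fin n × Fin n) K}
    (hq : q.totalDegree ≤ 1) (h : ren (swap a b) q = -q) {i j : Fin n} (hia : i ≠ a) (hib : i ≠ b)
    (hja : j ≠ a) (hjb : j ≠ b) : coeff (Finsupp.single (i, j) 1) q = 0 ∧ coeff 0 q = 0 := by
  have h' : rename (⇑(rowHom (swap a b) * colHom (swap a b))) q = -q := by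
    rw [ren_eq_row_col, vact_apply, vact_apply, rename_rename] at h
    rw [Perm.coe_mul]
    exact h
  refine ⟨coeff_eq_zero_of_rename_eq_neg h2 _ hq h' ?_, coeff_zero_eq_zero_of_rename_eq_neg h2 _ h'⟩
  simp [swap_apply_of_ne_of_ne hia hib, swap_apply_of_ne_of_ne hja hjb]

end TranspositionSigns

end Summit.ValiantsHypothesis.ValiantsHypothesis.Theorems

end
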